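import Summits.ABC.IUTFork.Cor312SlotHullSetLocality
import Summits.ABC.IUTFork.Cor312SlotHullJunction
import Summits.ABC.IUTFork.Cor312StatementGenuineMNonarch
import Summits.ABC.IUTFork.Cor312ThetaFiniteMSharp
import Summits.ABC.IUTFork.LDHGenuinePerImageExplicit
import Summits.ABC.IUTFork.LDHGenuineStepVSum
import Literature.IUT.LogVolume.GenuineLogThetaUnionPerImageResidue
import HarnessLib

/-!
# [IUTchIII] Corollary 3.12 — the JUNCTION of the readings (U) and (P) of `−|log(Θ)|`, part (iii): FROM EXACTNESS for ANY typed setting read by a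
# genuine Θ-volume input (`U = P + SR(I) ± Σ_{T(I)∖C} log p`, `=`/`↔` at slot-constant data, `SlotStatement ↔ (1.1) per image`), and at the M-LEVEL
# sharp settings `SlotStatement ⟹ Statement` with no side condition

PROOF-ONLY file (D-0012; no definitions, no `Prop` facts, nothing re-typed) of the abc-iut cell (R2 S-chain team, seat abc-iut-s2-p2 gen 4,
self-named row «U-P-JUNCTION-M»). TAKES NO SIDE on [IUTchIII] Cor. 3.12, on the reading (U)/(P) of `−|log(Θ)|`, or on any author. Junction
series: (i) `Cor312SlotHullJunction` (p464035, generic `SlotStatement ⟹ Statement` from monotonicity), (ii) `Cor312SlotHullJunctionK` (p464613,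
sharp `K`-setting), (iii-a) `Cor312SlotHullSetLocality` (slot-reading hull-set locality; M two routes). The M-level slot READ
(`negLogThetaSlot (settingPrVolSharpM …) = ↑I.negLogThetaPerImageNonarch`) is abc-iut-C-cert-2's `Cor312ThetaSlotM` chain and enters here ONLY as
the hypothesis `hP` of §3 (with `hU` = abc-iut-s2-p9's p449545 and `hq` = abc-iut-s2-p8's `negLogQ_…_eq_negAbsLogQ` at the M level; all three are
abc-iut-s2-p7's theorems at the sharp `K`-setting) — its instantiation at the M-level genuine settings is APPENDED when that READ lands.

S. Mochizuki, *Inter-universal Teichmüller theory III* [Mochizuki2012]: Cor. 3.12 p. 173 l. 43 – p. 174 l. 18 (READING (U): the hull of the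
union of ALL possible images — the cell's frozen `Cor312.Setting.thetaHull` / `negLogTheta` / `Statement`), proof Step (x) p. 181 and T. Dupuy,
A. Hilado [DupuyHilado2025] §4.9, §4.11–4.12 (READING (P): one hull per (Ind2)-slot image — abc-iut-C-cert-2's `Cor312SlotHull` p458847:
`negLogThetaSlot`, `SlotStatement`); *IUT IV* Thm. 1.10 Step (v) p. 27–28 (the symmetrisation that is exact only at slot-constant collections:
abc-iut-c312-d1 STEPV-IND1-NOTE; abc-iut-s2-p2 `GenuineLogThetaUnionPerImageResidue` p439062/p440845: at the input level
`|U − P − SR(I)| ≤ Σ_{p∈T(I)∖C} log p`, `SR(I) = P_Θ.slotResidue T(I)` the (Ind1) slot residue = `((l+1)/24)`× the log-`q` share at the MIXED primes).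

* §3 (`Cor312.Setting`, generic — the junction FROM EXACTNESS; the line-independent form of p464613 §4–§5): for ANY typed setting `P` with
  `hU : negLogTheta = ↑I.negLogThetaNonarch`, `hP : negLogThetaSlot = ↑I.negLogThetaPerImageNonarch`:
  **`negLogTheta_two_sided_negLogThetaSlot_of_exact`** (`U = P + SR(I) ± Σ_{p∈T(I)∖C} log p` for any slot-constant set `C`),
  `negLogThetaSlot_eq_negLogTheta_of_exact_of_slotConstant`, `slotStatement_iff_statement_of_exact_of_slotConstant` / `…_of_finrank_eq_one`, and with
  `hq : negLogQ = I.negAbsLogQ`: **`slotStatement_iff_cor312PerImageNonarchOf_of_exact`**, `statement_iff_cor312NonarchOf_of_exact`,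
  `cor312NonarchOf_of_slotStatement_of_exact`, `cor312PerImageNonarch_add_slotResidue_of_statement_of_exact`.
* §4 (`Thm311.Real`, M level, unconditional): **`statement_of_slotStatement_settingMSharp`** / `…_settingPrVolSharpM` — `SlotStatement ⟹ Statement` at
  BOTH M-level sharp settings for non-zero Θ-ideles that are units off a finite set (monotone log-volume and `ThetaFinite` are theorems there:
  abc-iut-w5-d166 `logvolMono_settingMSharp`, abc-iut-s2-p9 `thetaFinite_settingMSharp`; the summand route by part (iii-a)'s two-routes identities)
  — the (P)-line binders of M-line certificates imply the (U)-line binders at the same setting term; `negLogThetaSlot_le_negLogTheta_settingMSharp`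
  under `ThetaSlotFinite` (part (i) with `logvolMono_settingMSharp`).

USE (branch C, letter C «honest cost of γ», M line): as on the `K` line, the reading-(P) binders are print's reading-(U) binders EXACTLY at
slot-constant data and STRONGER by at most the datum's (Ind1) slot residue elsewhere — the quantity whose (U)-line cone binder is refuted as
typed (`Conditional.not_hreg_v4`, p453135). HONEST SCOPE: identities/inequalities between OUR typings; nothing asserts either statement at any
datum; typed ≠ proved. [cite: Mochizuki2012, IUTchIII Cor. 3.12 p. 173–174, proof Step (x) p. 181; Prop. 3.9 (ii) p. 116; Thm. 3.11 (i) p. 154]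
[cite: Mochizuki2012, IUTchI Def. 3.1 (e) p. 62] [cite: Mochizuki2012, IUTchIV Thm. 1.10 Step (v) p. 27–28] [cite: DupuyHilado2025, §1 (1.1), §4.7,
§4.9, §4.11–4.12] [claim: Mochizuki2012, status: disputed] for every quoted construction.
-/

noncomputable section

open Set Function NumberField IsDedekindDomain

/-! ## §3. The junction FROM EXACTNESS (generic over ANY typed setting read exactly by a genuine Θ-volume input) -/

namespace Summit.ABC.IUTFork.Cor312.Setting

open Thm311 Literature.IUT.LogThetaLattice Literature.IUT.LogVolume

variable {T : ThetaIndex} {S : Situation T} (P : Setting S)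
  {F₀ : Type} [Field F₀] [NumberField F₀] {K : Type} [Field K] [NumberField K] [Algebra F₀ K] (I : ThetaVolumeInput F₀ K)

/-- `ThetaSlotFinite` from an exact READ of `−|log(Θ)|_(P)` by a real number. [folklore] -/
theorem thetaSlotFinite_of_exact (hP : P.negLogThetaSlot = ((I.negLogThetaPerImageNonarch : ℝ) : WithTop ℝ)) : P.ThetaSlotFinite :=
  P.thetaSlotFinite_of_negLogThetaSlot_ne_top (by rw [hP]; exact WithTop.coe_ne_top)

/-- `ThetaFinite` from an exact READ of `−|log(Θ)|_(U)` by a real number. [folklore] -/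
theorem thetaFinite_of_exact (hU : P.negLogTheta = ((I.negLogThetaNonarch : ℝ) : WithTop ℝ)) : P.ThetaFinite :=
  P.thetaFinite_of_negLogTheta_ne_top (by rw [hU]; exact WithTop.coe_ne_top)

/-- **THE JUNCTION, two-sided, FROM EXACTNESS.** If the typed `−|log(Θ)|_(U)` and `−|log(Θ)|_(P)` of a setting `P` are read EXACTLY by a genuine
Θ-volume input `I` (`hU`, `hP`), then for any set `C ⊆ T(I)` of support primes at which `I` is SLOT-CONSTANT (one slot value `θ_i` over all places
of `F₀` above `p`): `−|log(Θ)|_(P) + ↑(SR(I) − Σ_{p∈T(I)∖C} log p) ≤ −|log(Θ)|_(U) ≤ −|log(Θ)|_(P) + ↑(SR(I) + Σ_{p∈T(I)∖C} log p)`, where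
`SR(I) = P_Θ.slotResidue T(I)` is the (Ind1) SLOT RESIDUE of the pilot data (abc-iut-S8; = `((l+1)/24)`× the log-`q` share at the MIXED primes,
two-sided, abc-iut-s2-p2 `PilotSlotResidueMixedShare`) — abc-iut-s2-p2's input-level identity `negLogThetaNonarch_perImage_two_sided_of_slotConstantOn`
(p440845). [cite: Mochizuki2012, IUTchIII Cor. 3.12 p. 173–174, proof Step (x) p. 181; Thm. 3.11 (i) (Ind1) p. 154] [cite: Mochizuki2012, IUTchIV
Thm. 1.10 Step (v) p. 27–28] [cite: DupuyHilado2025, §4.7, §4.11–4.12] [claim: Mochizuki2012, status: disputed] -/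
theorem negLogTheta_two_sided_negLogThetaSlot_of_exact
    (hU : P.negLogTheta = ((I.negLogThetaNonarch : ℝ) : WithTop ℝ))
    (hP : P.negLogThetaSlot = ((I.negLogThetaPerImageNonarch : ℝ) : WithTop ℝ))
    (C : Finset ℕ) (hC : C ⊆ I.supportPrimes)
    (hconst : ∀ p ∈ C, ∀ (i : Fin I.X.lstar) (v w : placesOver F₀ p), I.X.slotValue i v.1 = I.X.slotValue i w.1) :
    P.negLogThetaSlot + (((I.X.slotResidue I.supportPrimes - ∑ p ∈ I.supportPrimes \ C, Real.log p : ℝ)) : WithTop ℝ) ≤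
        P.negLogTheta ∧
      P.negLogTheta ≤
        P.negLogThetaSlot + (((I.X.slotResidue I.supportPrimes + ∑ p ∈ I.supportPrimes \ C, Real.log p : ℝ)) : WithTop ℝ) := by
  rw [hU, hP, ← WithTop.coe_add, ← WithTop.coe_add, WithTop.coe_le_coe, WithTop.coe_le_coe]
  have h := I.negLogThetaNonarch_perImage_two_sided_of_slotConstantOn C hC hconst
  constructor <;> linarith [h.1, h.2]

/-- **… with no slot-constancy information** (`C = ∅`): `|−|log(Θ)|_(U) − −|log(Θ)|_(P) − SR(I)| ≤ Σ_{p∈T(I)} log p` (at a genuine datum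
`Σ_{p∈T(I)} log p ≤ 2·d_mod·(log-diff + log-cond) + log(30·l)`, abc-iut-S3). [cite: Mochizuki2012, IUTchIII Cor. 3.12 p. 173–174, proof Step (x)
p. 181] [cite: Mochizuki2012, IUTchIV Thm. 1.10 Step (v) p. 27–28] [claim: Mochizuki2012, status: disputed] -/
theorem negLogTheta_two_sided_negLogThetaSlot_of_exact'
    (hU : P.negLogTheta = ((I.negLogThetaNonarch : ℝ) : WithTop ℝ))
    (hP : P.negLogThetaSlot = ((I.negLogThetaPerImageNonarch : ℝ) : WithTop ℝ)) :
    P.negLogThetaSlot + (((I.X.slotResidue I.supportPrimes - ∑ p ∈ I.supportPrimes, Real.log p : ℝ)) : WithTop ℝ) ≤ P.negLogTheta ∧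
      P.negLogTheta ≤ P.negLogThetaSlot + (((I.X.slotResidue I.supportPrimes + ∑ p ∈ I.supportPrimes, Real.log p : ℝ)) : WithTop ℝ) := by
  have h := P.negLogTheta_two_sided_negLogThetaSlot_of_exact I hU hP ∅ (Finset.empty_subset _)
    (fun p hp => absurd hp (Finset.notMem_empty p))
  rwa [Finset.sdiff_empty] at h

/-- **COINCIDENCE AT SLOT-CONSTANT DATA, from exactness**: if `I` is slot-constant at EVERY support prime (every `d_mod = 1` datum; every input whose
`F₀` has one place over each support prime), then `−|log(Θ)|_(P) = −|log(Θ)|_(U)` — reading (P) costs NOTHING more than print's reading (U) there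
([IUTchIV] Step (v)'s symmetrisation is exact; abc-iut-s2-p2 `negLogThetaNonarch_eq_perImage_of_slotConstant`).
[cite: Mochizuki2012, IUTchIII Cor. 3.12 p. 173–174, proof Step (x) p. 181] [cite: Mochizuki2012, IUTchIV Thm. 1.10 Step (v) p. 28]
[cite: DupuyHilado2025, §4.7, §4.12] [claim: Mochizuki2012, status: disputed] -/
theorem negLogThetaSlot_eq_negLogTheta_of_exact_of_slotConstant
    (hU : P.negLogTheta = ((I.negLogThetaNonarch : ℝ) : WithTop ℝ))
    (hP : P.negLogThetaSlot = ((I.negLogThetaPerImageNonarch : ℝ) : WithTop ℝ))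
    (hconst : ∀ p ∈ I.supportPrimes, ∀ (i : Fin I.X.lstar) (v w : placesOver F₀ p), I.X.slotValue i v.1 = I.X.slotValue i w.1) :
    P.negLogThetaSlot = P.negLogTheta := by
  rw [hU, hP, I.negLogThetaNonarch_eq_perImage_of_slotConstant hconst]

/-- **`SlotStatement ↔ Statement` AT SLOT-CONSTANT DATA, from exactness**: the reading-(P) conclusion of [IUTchIII] Cor. 3.12 and print's
reading-(U) conclusion are THE SAME CLAIM there. [cite: Mochizuki2012, IUTchIII Cor. 3.12 p. 174 l. 16–18, proof Step (x) p. 181]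
[claim: Mochizuki2012, status: disputed] -/
theorem slotStatement_iff_statement_of_exact_of_slotConstant
    (hU : P.negLogTheta = ((I.negLogThetaNonarch : ℝ) : WithTop ℝ))
    (hP : P.negLogThetaSlot = ((I.negLogThetaPerImageNonarch : ℝ) : WithTop ℝ))
    (hconst : ∀ p ∈ I.supportPrimes, ∀ (i : Fin I.X.lstar) (v w : placesOver F₀ p), I.X.slotValue i v.1 = I.X.slotValue i w.1) :
    P.SlotStatement ↔ P.Statement :=
  P.slotStatement_iff_statement_of_negLogThetaSlot_eq (P.negLogThetaSlot_eq_negLogTheta_of_exact_of_slotConstant I hU hP hconst)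

/-- **… in particular for `F₀` of degree one** (`d_mod = 1`: one place of `F₀` over each prime, abc-iut-c312-d1 `DHData.slotConstant_of_finrank_eq_one`):
RISK 7 / the (Ind1) slot residue is void there. [cite: Mochizuki2012, IUTchIII Cor. 3.12 p. 174 l. 16–18] [claim: Mochizuki2012, status: disputed] -/
theorem slotStatement_iff_statement_of_exact_of_finrank_eq_one
    (hU : P.negLogTheta = ((I.negLogThetaNonarch : ℝ) : WithTop ℝ))
    (hP : P.negLogThetaSlot = ((I.negLogThetaPerImageNonarch : ℝ) : WithTop ℝ)) (hF : Module.finrank ℚ F₀ = 1) :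
    P.SlotStatement ↔ P.Statement :=
  P.slotStatement_iff_statement_of_exact_of_slotConstant I hU hP fun p hp i v w => by
    haveI : Fact p.Prime := ⟨I.prime_of_mem_supportPrimes hp⟩
    exact DHData.slotConstant_of_finrank_eq_one hF (fun u => I.X.slotValue i u.1) v w

/-- **`SlotStatement ↔ I.Cor312PerImageNonarchOf` from exactness**: if the setting's `−|log(q)|` is the input's `−|log(q)|` (`hq`) and its
`−|log(Θ)|_(P)` is read exactly (`hP`), the typed reading-(P) conclusion of [IUTchIII] Cor. 3.12 IS «Dupuy–Hilado's (1.1) PER IMAGE, nonarchimedean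
form» for the genuine input (abc-iut-S7 `ThetaVolumeInput.Cor312PerImageNonarchOf`). [cite: Mochizuki2012, IUTchIII Cor. 3.12 p. 174 l. 4–18, proof
Step (x) p. 181] [cite: DupuyHilado2025, §1 (1.1), §4.12] [claim: Mochizuki2012, status: disputed] -/
theorem slotStatement_iff_cor312PerImageNonarchOf_of_exact (hq : P.negLogQ = I.negAbsLogQ)
    (hP : P.negLogThetaSlot = ((I.negLogThetaPerImageNonarch : ℝ) : WithTop ℝ)) :
    P.SlotStatement ↔ I.Cor312PerImageNonarchOf := by
  unfold SlotStatement ThetaVolumeInput.Cor312PerImageNonarchOf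
  rw [hq, hP, WithTop.coe_le_coe]
  exact ⟨fun h => h.2, fun h => ⟨WithTop.coe_ne_top, h⟩⟩

/-- **`Statement ↔ I.Cor312NonarchOf` from exactness** (the reading-(U) twin; at the sharp `K`-setting abc-iut-s2-p7 p453952, at the M level
abc-iut-s2-p7 `statement_settingMSharp_genuine_iff_cor312NonarchOf`). [cite: Mochizuki2012, IUTchIII Cor. 3.12 p. 174 l. 4–18]
[cite: DupuyHilado2025, §1 (1.1)] [claim: Mochizuki2012, status: disputed] -/
theorem statement_iff_cor312NonarchOf_of_exact (hq : P.negLogQ = I.negAbsLogQ)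
    (hU : P.negLogTheta = ((I.negLogThetaNonarch : ℝ) : WithTop ℝ)) :
    P.Statement ↔ I.Cor312NonarchOf := by
  unfold Statement ThetaVolumeInput.Cor312NonarchOf
  rw [hq, hU, WithTop.coe_le_coe]
  exact ⟨fun h => h.2, fun h => ⟨WithTop.coe_ne_top, h⟩⟩

/-- **Per datum, from exactness: the reading-(P) conclusion implies Dupuy–Hilado's (1.1) in BOTH forms** (`I.Cor312PerImageNonarchOf` and — the
(P) number being the smaller, abc-iut-S-d1 — `I.Cor312NonarchOf`). [cite: Mochizuki2012, IUTchIII Cor. 3.12 p. 174] [cite: DupuyHilado2025, §1 (1.1)]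
[claim: Mochizuki2012, status: disputed] -/
theorem cor312NonarchOf_of_slotStatement_of_exact (hq : P.negLogQ = I.negAbsLogQ)
    (hP : P.negLogThetaSlot = ((I.negLogThetaPerImageNonarch : ℝ) : WithTop ℝ)) (hst : P.SlotStatement) :
    I.Cor312PerImageNonarchOf ∧ I.Cor312NonarchOf := by
  have h := (P.slotStatement_iff_cor312PerImageNonarchOf_of_exact I hq hP).mp hst
  exact ⟨h, DHData.cor312NonarchOf_of_cor312PerImageNonarchOf I h⟩

/-- **HOW MUCH STRONGER (P) IS, per datum, from exactness**: the reading-(U) conclusion yields Dupuy–Hilado's (1.1) PER IMAGE weakened by EXACTLY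
the (Ind1) slot residue of the pilot data plus the rounding sum: `−|log(q)| ≤ −|log(Θ)|_(P)^nonarch(I) + (SR(I) + Σ_{p∈T(I)} log p)` (abc-iut-s2-p2
`negLogThetaNonarch_le_perImage_add_slotResidue`). [cite: Mochizuki2012, IUTchIII Cor. 3.12 p. 174, proof Step (x) p. 181] [cite: Mochizuki2012,
IUTchIV Thm. 1.10 Step (v) p. 27–28] [cite: DupuyHilado2025, §1 (1.1), §4.7, §4.12] [claim: Mochizuki2012, status: disputed] -/
theorem cor312PerImageNonarch_add_slotResidue_of_statement_of_exact (hq : P.negLogQ = I.negAbsLogQ)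
    (hU : P.negLogTheta = ((I.negLogThetaNonarch : ℝ) : WithTop ℝ)) (hst : P.Statement) :
    I.negAbsLogQ ≤ I.negLogThetaPerImageNonarch + (I.X.slotResidue I.supportPrimes + ∑ p ∈ I.supportPrimes, Real.log p) := by
  have hU' : I.Cor312NonarchOf := (P.statement_iff_cor312NonarchOf_of_exact I hq hU).mp hst
  unfold ThetaVolumeInput.Cor312NonarchOf at hU'
  linarith [I.negLogThetaNonarch_le_perImage_add_slotResidue]

end Summit.ABC.IUTFork.Cor312.Setting

/-! ## §4. M level, unconditional: `SlotStatement ⟹ Statement` at the sharp settings; `−|log(Θ)|_(P) ≤ −|log(Θ)|_(U)` under `ThetaSlotFinite` -/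

namespace Summit.ABC.IUTFork.Thm311.Real

open Cor312 Cor312Vol Literature.IUT.LogThetaLattice Literature.IUT.LogVolume Literature.IUT.HodgeTheaters
  Literature.NumberTheory.NumberFields

section Unconditional

variable {F K Fbar : Type} [Field F] [NumberField F] [Field K] [NumberField K] [Algebra F K]
  [Field Fbar] [Algebra F Fbar] [Algebra K Fbar] {E : WeierstrassCurve F} [E.IsElliptic] {l : ℕ}
  {Pb : BadPlacePredicates K} (D : InitialThetaData F K Fbar E l Pb) {logvK : PadicLogsVal K}
  (hlog : LogvAnalyticVal logvK) (M : Type) [Field M] [NumberField M]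
  (archPk : ∀ (j : (thetaIndexOfInitial D).Label) (vQ : (thetaIndexOfInitial D).VQ),
    Set ((logShellsOfInitialDH D logvK).Packet j vQ))
  (archSub : ∀ (j : (thetaIndexOfInitial D).Label) (v : (thetaIndexOfInitial D).V),
    Set ((logShellsOfInitialDH D logvK).Packet j ((thetaIndexOfInitial D).over v)))
  (Ψ : ℤ → ∀ v : (thetaIndexOfInitial D).V, v ∈ (thetaIndexOfInitial D).Vbad →
    Set ((logShellsOfInitialDH D logvK).StarPacket v))
  (act : ℤ → ∀ v : (thetaIndexOfInitial D).V, v ∈ (thetaIndexOfInitial D).Vbad →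
    (logShellsOfInitialDH D logvK).StarPacket v → Module.End ℚ ((logShellsOfInitialDH D logvK).StarPacket v))
  (Mmod : ℤ → ∀ j : (thetaIndexOfInitial D).LabelStar, Set ((logShellsOfInitialDH D logvK).GlobalPacket j.1))
  (region : ℤ → ∀ j : (thetaIndexOfInitial D).LabelStar, FinDivisor M → ∀ vQ : (thetaIndexOfInitial D).VQ,
    Set ((logShellsOfInitialDH D logvK).Packet j.1 vQ))
  (n : ℤ) {HT : Type} {LogLink : HT → HT → Type} {IsFull : ∀ {s t : HT}, LogLink s t → Prop}
  (lat : LGPGaussianLogThetaLattice LogLink IsFull)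
  {Frd : Type} {IsoF : Frd → Frd → Type} {Ob : Frd → Type} {realify : Frd → Frd} {Strip : Type}
  {IsoS : Strip → Strip → Type}
  {Mv : ∀ v : (thetaIndexOfInitial D).V, v ∈ (thetaIndexOfInitial D).Vbad → Type} [∀ v h, Monoid (Mv v h)]
  (sig : GlobalLGPFrobenioidSignature (thetaIndexOfInitial D).lstar (thetaIndexOfInitial D).V
    (· ∈ (thetaIndexOfInitial D).Vbad) Frd IsoF Ob realify Strip IsoS Mv)
  (split : SplittingMonoids Mv) {ObΔ : Type}
  {N : ∀ v : (thetaIndexOfInitial D).V, v ∈ (thetaIndexOfInitial D).Vbad → Type} [∀ v h, Monoid (N v h)]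
  (qData : QPilotData ObΔ N)
  (t : ∀ (u : FinitePlace ℚ) (_ : Fin (thetaIndexOfInitial D).lstar) (x : (thetaIndexOfInitial D).Fibre (Val.non u)),
    kOfM D (ratChar u) u (natCast_ratChar_mem u) x)
  (tq : ∀ (u : FinitePlace ℚ) (x : (thetaIndexOfInitial D).Fibre (Val.non u)),
    kOfM D (ratChar u) u (natCast_ratChar_mem u) x)
  (htq0 : ∀ u x, tq u x ≠ 0) (Sq : Finset (FinitePlace ℚ))
  (htq1 : ∀ (u : FinitePlace ℚ) (x : (thetaIndexOfInitial D).Fibre (Val.non u)), u ∉ Sq → ‖tq u x‖ = 1)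
  (ht0 : ∀ u i x, t u i x ≠ 0) (Sθ : Finset (FinitePlace ℚ))
  (ht1 : ∀ (u : FinitePlace ℚ) (i : Fin (thetaIndexOfInitial D).lstar) (x : (thetaIndexOfInitial D).Fibre (Val.non u)),
    u ∉ Sθ → ‖t u i x‖ = 1)

include ht0 Sθ ht1 in
/-- **`SlotStatement ⟹ Statement` at the frames-route M-level sharp setting, NO side condition** (non-zero Θ-ideles, units off a finite set `S_Θ`;
any `q`-ideles units off `Sq`): monotone log-volume (abc-iut-w5-d166 `logvolMono_settingMSharp`) and `ThetaFinite` (abc-iut-s2-p9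
`thetaFinite_settingMSharp`) are THEOREMS there, so part (i)'s `statement_of_slotStatement` applies outright — the (P)-line binders of M-line
certificates imply the (U)-line binders at the same setting term. [cite: Mochizuki2012, IUTchIII Cor. 3.12 p. 174 l. 16–18; Prop. 3.9 (ii) p. 116]
[claim: Mochizuki2012, status: disputed] -/
theorem statement_of_slotStatement_settingMSharp
    (h : (settingMSharp D hlog M archPk archSub Ψ act Mmod region n lat sig split qData t tq htq0 Sq htq1).SlotStatement) :
    (settingMSharp D hlog M archPk archSub Ψ act Mmod region n lat sig split qData t tq htq0 Sq htq1).Statement :=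
  Cor312.Setting.statement_of_slotStatement _
    (logvolMono_settingMSharp D hlog M archPk archSub Ψ act Mmod region n lat sig split qData t tq htq0 Sq htq1)
    (thetaFinite_settingMSharp D hlog M archPk archSub Ψ act Mmod region n lat sig split qData t tq htq0 Sq htq1 ht0 Sθ ht1) h

include ht0 Sθ ht1 in
/-- **`SlotStatement ⟹ Statement` at the summand-route M-level sharp setting** (§2's two-routes identities). [cite: Mochizuki2012, IUTchIII Cor. 3.12
p. 174 l. 16–18; Prop. 3.9 (ii) p. 116] [claim: Mochizuki2012, status: disputed] -/
theorem statement_of_slotStatement_settingPrVolSharpM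
    (h : (settingPrVolSharpM D hlog t tq M archPk archSub Ψ act Mmod region n lat sig split qData htq0 Sq htq1).SlotStatement) :
    (settingPrVolSharpM D hlog t tq M archPk archSub Ψ act Mmod region n lat sig split qData htq0 Sq htq1).Statement := by
  rw [← statement_settingMSharp_iff_settingPrVolSharpM]
  rw [← slotStatement_settingMSharp_iff_settingPrVolSharpM] at h
  exact statement_of_slotStatement_settingMSharp D hlog M archPk archSub Ψ act Mmod region n lat sig split qData t tq htq0 Sq htq1 ht0 Sθ
    ht1 h

/-- **`−|log(Θ)|_(P) ≤ −|log(Θ)|_(U)` at the frames-route M-level sharp setting**, under `ThetaSlotFinite` (a theorem once the slot term is READ —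
abc-iut-C-cert-2's M-level slot chain; cf. §3 `thetaSlotFinite_of_exact`). [cite: Mochizuki2012, IUTchIII Cor. 3.12 p. 173–174, proof Step (x) p. 181;
Prop. 3.9 (ii) p. 116] [cite: DupuyHilado2025, §4.12] [claim: Mochizuki2012, status: disputed] -/
theorem negLogThetaSlot_le_negLogTheta_settingMSharp
    (hfinP : (settingMSharp D hlog M archPk archSub Ψ act Mmod region n lat sig split qData t tq htq0 Sq htq1).ThetaSlotFinite) :
    (settingMSharp D hlog M archPk archSub Ψ act Mmod region n lat sig split qData t tq htq0 Sq htq1).negLogThetaSlot ≤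
      (settingMSharp D hlog M archPk archSub Ψ act Mmod region n lat sig split qData t tq htq0 Sq htq1).negLogTheta :=
  Cor312.Setting.negLogThetaSlot_le_negLogTheta _
    (logvolMono_settingMSharp D hlog M archPk archSub Ψ act Mmod region n lat sig split qData t tq htq0 Sq htq1) hfinP

end Unconditional

end Summit.ABC.IUTFork.Thm311.Real

end
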